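import Literature.NumberTheory.Sieve.RoughOmegaCells
import Literature.NumberTheory.Sieve.BuchstabIterationWeights
import Literature.NumberTheory.LFunctions.PrimeSumStandardWeights
import HarnessLib

/-!
# Ω-cells of the rough integers: the inductive step of Alladi's asymptotic (assembly)

Topic `Literature/NumberTheory/Sieve`. Everything here is PROVED. Write
`Ψ_j(X, N) = #{b ∈ roughIcc N X : Ω(b) = j}` for the `Ω`-cells of the `N`-rough integers up to `X`
(`RoughOmegaCells.lean`) and let `F : ℕ → ℝ → ℝ` be ANY family of densities; the main term attached to
the `Ω = i+1` cell is `X F_i(u)/log X − [i = 0] Y/log Y`, `u = log X/log Y` (for the Alladi–Buchstab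
densities `F_i = I_{i+1}` this is Alladi's theorem; the prime `i = 0` carries the secondary term of the
prime number theorem). This file is the `Ω`-refined copy of `RoughNumbersBuchstabStep.lean`:

* `abs_sum_cell_sub_sum_main_le` — the hypothesis `P_i(k, C)` summed over the primes of the Buchstab
  range (each `(x/p, p)` costs `C x/(p log² p)`, `∑ 1/p = O(1)`);
* `abs_cell_sub_main_step_of` — assembly of the step `k → k+1` for the `Ω = i+2` cells with all
  parameters given: the Ω-refined Buchstab identity (`card_roughIcc_filter_cardFactors_eq_add_sum`),
  `P_{i+1}(k)` at `(x, z)`, `P_i(k)` at the `(x/p, p)`, the main sum for the weight `σ_i(s) = F_i(s)/s`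
  (`abs_sum_weight_sub_main_le`) and `∑ p/log p`; the recursion enters only as the hypothesis
  `∫_{k−1}^{u−1} σ_i = F_{i+1}(u) − F_{i+1}(k)`.

The self-contained step, the regularity of the weights and the induction are in
`RoughOmegaCellsDensityWeights.lean` / `RoughOmegaCellsAsymptotic.lean`.

## References

* K. Alladi, *The distribution of ν(n) in the sieve of Eratosthenes*, Quart. J. Math. Oxford (2) 33
  (1982), 129–148. [Alladi1982]
* G. Tenenbaum, *Introduction to analytic and probabilistic number theory*, Ch. III.6. [Tenenbaum2015]
* G. Harman, *Prime-Detecting Sieves* (2007), Appendix A.2 (the induction for `Φ(x, y)`). [Harman2007]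
-/

open Finset Real MeasureTheory Set
open scoped Chebyshev

noncomputable section

namespace Literature.NumberTheory.Sieve

/-! ### Summing the induction hypothesis over the primes of the Buchstab range -/

/-- **The hypothesis `P_i(k, C)` summed over the primes of the Buchstab range** (Ω-cell version of
`abs_sum_card_sub_sum_main_le`): each term `(x/p, p)` costs `≤ C x/(p log² p)` and `∑ 1/p = O(1)`.
[folklore] -/
theorem abs_sum_cell_sub_sum_main_le {F : ℕ → ℝ → ℝ} {i k : ℕ} {C C₀ x y a b : ℝ} (hC : 0 ≤ C)
    (hC₀ : 0 ≤ C₀) (hE : ∀ t : ℝ, 2 ≤ t → |θ t - t| ≤ C₀ * t / Real.log t ^ 2)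
    (ha : Real.exp 1 ≤ a) (hab : a ≤ b) (hba : Real.log b ≤ 3 * Real.log a) (hy : 1 < y)
    (hx : 0 ≤ x)
    (hP : ∀ X Y : ℝ, 2 ≤ Y → Y ≤ X → Real.log X ≤ k * Real.log Y →
      |((((roughIcc ⌈Y⌉₊ ⌊X⌋₊).filter
          (fun b => ArithmeticFunction.cardFactors b = i + 1)).card : ℕ) : ℝ) -
        (X * F i (Real.log X / Real.log Y) / Real.log X - if i = 0 then Y / Real.log Y else 0)| ≤
        C * X / Real.log Y ^ 2)
    (hpy : ∀ p ∈ (Finset.Ioc ⌊a⌋₊ ⌊b⌋₊).filter Nat.Prime, y ≤ (p : ℝ))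
    (hpx : ∀ p ∈ (Finset.Ioc ⌊a⌋₊ ⌊b⌋₊).filter Nat.Prime, (p : ℝ) ^ 2 ≤ x)
    (hxp : ∀ p ∈ (Finset.Ioc ⌊a⌋₊ ⌊b⌋₊).filter Nat.Prime, Real.log x ≤ (k + 1) * Real.log p) :
    |∑ p ∈ (Finset.Ioc ⌊a⌋₊ ⌊b⌋₊).filter Nat.Prime,
        ((((roughIcc p (⌊x⌋₊ / p)).filter
          (fun b => ArithmeticFunction.cardFactors b = i + 1)).card : ℕ) : ℝ) -
      ∑ p ∈ (Finset.Ioc ⌊a⌋₊ ⌊b⌋₊).filter Nat.Prime,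
        (x / p * F i (Real.log x / Real.log p - 1) / (Real.log x - Real.log p) -
          if i = 0 then (p : ℝ) / Real.log p else 0)| ≤
      C * (3 + 8 * C₀) * x / Real.log y ^ 2 := by
  set S := (Finset.Ioc ⌊a⌋₊ ⌊b⌋₊).filter Nat.Prime with hS
  have hly : 0 < Real.log y := Real.log_pos hy
  -- termwise: the hypothesis at `(x/p, p)`
  have hterm : ∀ p ∈ S, |((((roughIcc p (⌊x⌋₊ / p)).filter
        (fun b => ArithmeticFunction.cardFactors b = i + 1)).card : ℕ) : ℝ) -
      (x / p * F i (Real.log x / Real.log p - 1) / (Real.log x - Real.log p) -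
        if i = 0 then (p : ℝ) / Real.log p else 0)| ≤ C * x / Real.log y ^ 2 * (p : ℝ)⁻¹ := by
    intro p hp
    have hpP := (Finset.mem_filter.mp hp).2
    have hp2 : (2 : ℝ) ≤ p := by exact_mod_cast hpP.two_le
    have hp0 : (0 : ℝ) < p := by linarith
    have hpp : (p : ℝ) ≤ x / p := by
      rw [le_div_iff₀ hp0, ← sq]; exact hpx p hp
    have hx0' : 0 < x := lt_of_lt_of_le (by positivity) (hpx p hp)
    have hlogp : 0 < Real.log p := Real.log_pos (by linarith)
    have hlog : Real.log (x / p) = Real.log x - Real.log p := Real.log_div hx0'.ne' hp0.ne'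
    have hcond : Real.log (x / p) ≤ k * Real.log p := by
      rw [hlog]; have := hxp p hp; linarith
    have h := hP (x / p) p hp2 hpp hcond
    have key : (Real.log x - Real.log p) / Real.log p = Real.log x / Real.log p - 1 := by
      rw [sub_div, div_self hlogp.ne']
    rw [Nat.ceil_natCast, Nat.floor_div_natCast, hlog, key] at h
    refine h.trans ?_
    have hlyp : Real.log y ≤ Real.log p := Real.log_le_log (by linarith) (hpy p hp)
    calc C * (x / p) / Real.log p ^ 2 = C * x / Real.log p ^ 2 * (p : ℝ)⁻¹ := by
          field_simp
      _ ≤ C * x / Real.log y ^ 2 * (p : ℝ)⁻¹ := by gcongr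
  have hsum := Literature.NumberTheory.LFunctions.sum_primes_Ioc_inv_le ha hab hC₀ hE
  have ha0 : 0 < a := (Real.exp_pos 1).trans_le ha
  have hla : 1 ≤ Real.log a := by rw [Real.le_log_iff_exp_le ha0]; exact ha
  have hratio : Real.log b / Real.log a ≤ 3 := by rw [div_le_iff₀ (by linarith)]; exact hba
  have hx0 : 0 ≤ C * x / Real.log y ^ 2 := by positivity
  rw [← Finset.sum_sub_distrib]
  refine (Finset.abs_sum_le_sum_abs _ _).trans ?_
  calc ∑ p ∈ S, |((((roughIcc p (⌊x⌋₊ / p)).filter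
          (fun b => ArithmeticFunction.cardFactors b = i + 1)).card : ℕ) : ℝ) -
        (x / p * F i (Real.log x / Real.log p - 1) / (Real.log x - Real.log p) -
          if i = 0 then (p : ℝ) / Real.log p else 0)|
      ≤ ∑ p ∈ S, C * x / Real.log y ^ 2 * (p : ℝ)⁻¹ := Finset.sum_le_sum hterm
    _ = C * x / Real.log y ^ 2 * ∑ p ∈ S, (p : ℝ)⁻¹ := by rw [Finset.mul_sum]
    _ ≤ C * x / Real.log y ^ 2 * ((1 + 2 * C₀) * (Real.log b / Real.log a) + 2 * C₀) := by
        gcongr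
    _ ≤ C * x / Real.log y ^ 2 * ((1 + 2 * C₀) * 3 + 2 * C₀) := by gcongr
    _ = C * (3 + 8 * C₀) * x / Real.log y ^ 2 := by ring

/-! ### The inductive step `k → k + 1` for the `Ω = i + 2` cells (assembly with all parameters given) -/

/-- **Assembly of the inductive step for the Ω-cells** (Ω-cell version of
`abs_card_roughIcc_sub_main_step_of`; all elementary inequalities between the parameters
`y < z = x^{1/k}`, `a = ⌈y⌉ − 1`, `b = ⌈z⌉ − 1` are hypotheses, as are the regularity data of the
weight `σ(s) = F_i(s)/s` on `s ∈ [k−1, 2k+1]` and the recursion `∫_{k−1}^{u−1} σ = F_{i+1}(u) − F_{i+1}(k)`):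
the Ω-refined Buchstab identity, the hypotheses `P_{i+1}(k, C)` at `(x, z)` and `P_i(k, C')` at the
`(x/p, p)`, the main sum and `∑ p/log p`. [cite: Alladi1982, §2] -/
theorem abs_cell_sub_main_step_of {F : ℕ → ℝ → ℝ} {σ' : ℝ → ℝ} {i k : ℕ} (hk : 2 ≤ k)
    {C C' C₀ B B' : ℝ} (hC : 0 ≤ C) (hC' : 0 ≤ C') (hC₀ : 0 ≤ C₀) (hB : 0 ≤ B) (hB' : 0 ≤ B')
    (hE : ∀ t : ℝ, 2 ≤ t → |θ t - t| ≤ C₀ * t / Real.log t ^ 2)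
    (hPsame : ∀ X Y : ℝ, 2 ≤ Y → Y ≤ X → Real.log X ≤ k * Real.log Y →
      |((((roughIcc ⌈Y⌉₊ ⌊X⌋₊).filter
          (fun b => ArithmeticFunction.cardFactors b = i + 1 + 1)).card : ℕ) : ℝ) -
        X * F (i + 1) (Real.log X / Real.log Y) / Real.log X| ≤ C * X / Real.log Y ^ 2)
    (hPprev : ∀ X Y : ℝ, 2 ≤ Y → Y ≤ X → Real.log X ≤ k * Real.log Y →
      |((((roughIcc ⌈Y⌉₊ ⌊X⌋₊).filter
          (fun b => ArithmeticFunction.cardFactors b = i + 1)).card : ℕ) : ℝ) -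
        (X * F i (Real.log X / Real.log Y) / Real.log X - if i = 0 then Y / Real.log Y else 0)| ≤
        C' * X / Real.log Y ^ 2)
    {x y z a b : ℝ} {N M : ℕ} (hNdef : ⌈y⌉₊ = N) (hMdef : ⌈z⌉₊ = M) (hNM : N ≤ M)
    (hS : (Finset.Ico N M).filter Nat.Prime = (Finset.Ioc ⌊a⌋₊ ⌊b⌋₊).filter Nat.Prime)
    (hx0 : 0 < x) (hx1 : 1 ≤ x) (hy1 : 1 < y) (hly : 0 < Real.log y)
    (hz0 : 0 < z) (hz2 : 2 ≤ z) (hzx : z ≤ x) (hzz : z * z ≤ x) (hyz : y ≤ z)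
    (hlz : Real.log y < Real.log z) (hz_log : Real.log z = Real.log x / k)
    (hyu : (k : ℝ) ≤ Real.log x / Real.log y)
    (hea : Real.exp 1 ≤ a) (hay : a ≤ y) (hya : y ≤ a + 1) (hab : a ≤ b) (hbz : b < z)
    (hzb : z ≤ b + 1) (hb0 : 0 < b) (hlb : Real.log b ≤ 3 * Real.log a)
    (hlya : Real.log y ≤ 2 * Real.log a) (hxa : Real.log x ≤ 2 * (k + 1) * Real.log a)
    (hpy : ∀ p ∈ (Finset.Ioc ⌊a⌋₊ ⌊b⌋₊).filter Nat.Prime, y ≤ (p : ℝ))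
    (hpx : ∀ p ∈ (Finset.Ioc ⌊a⌋₊ ⌊b⌋₊).filter Nat.Prime, (p : ℝ) ^ 2 ≤ x)
    (hxp : ∀ p ∈ (Finset.Ioc ⌊a⌋₊ ⌊b⌋₊).filter Nat.Prime, Real.log x ≤ (k + 1) * Real.log p)
    (hσc : ContinuousOn (fun s => F i s / s) (Set.Icc ((k : ℝ) - 1) (2 * k + 1)))
    (hσ : ∀ s : ℝ, (k : ℝ) - 1 < s → s ≤ 2 * k + 1 → HasDerivAt (fun s => F i s / s) (σ' s) s)
    (hσ'c : ContinuousOn σ' (Set.Ioc ((k : ℝ) - 1) (2 * k + 1)))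
    (hσb : ∀ s : ℝ, (k : ℝ) - 1 ≤ s → s ≤ 2 * k + 1 → |F i s / s| ≤ B)
    (hσ'b : ∀ s : ℝ, (k : ℝ) - 1 < s → s ≤ 2 * k + 1 → |σ' s| ≤ B')
    (hrec : ∫ s in ((k : ℝ) - 1)..(Real.log x / Real.log y - 1), F i s / s =
      F (i + 1) (Real.log x / Real.log y) - F (i + 1) k) :
    |((((roughIcc ⌈y⌉₊ ⌊x⌋₊).filter
        (fun b => ArithmeticFunction.cardFactors b = i + 1 + 1)).card : ℕ) : ℝ) -
      x * F (i + 1) (Real.log x / Real.log y) / Real.log x| ≤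
      (C + C' * (3 + 8 * C₀) + 4 * ((2 + 3 * (2 * (k + 1) * B' + 3 * B)) * C₀ * (B + 1) + 2 * B) +
        4 * (1 + 5 * C₀)) * x / Real.log y ^ 2 := by
  have hk2 : (2 : ℝ) ≤ k := by exact_mod_cast hk
  have hk0 : (0 : ℝ) < k := by linarith
  have ha0 : 0 < a := (Real.exp_pos 1).trans_le hea
  have hla : 1 ≤ Real.log a := by rw [Real.le_log_iff_exp_le ha0]; exact hea
  have hLx : 0 < Real.log x := by
    have : 0 < Real.log x / Real.log y := hk0.trans_le hyu
    exact (div_pos_iff_of_pos_right hly).mp this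
  set S := (Finset.Ioc ⌊a⌋₊ ⌊b⌋₊).filter Nat.Prime with hS_def
  set X := ⌊x⌋₊ with hX
  -- the Ω-refined Buchstab identity
  have hBuch := card_roughIcc_filter_cardFactors_eq_add_sum hNM X (i + 1)
  rw [hS] at hBuch
  have hΦ : ((((roughIcc N X).filter
        (fun b => ArithmeticFunction.cardFactors b = i + 1 + 1)).card : ℕ) : ℝ) =
      ((((roughIcc M X).filter
        (fun b => ArithmeticFunction.cardFactors b = i + 1 + 1)).card : ℕ) : ℝ) +
      ∑ p ∈ S, ((((roughIcc p (X / p)).filter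
        (fun b => ArithmeticFunction.cardFactors b = i + 1)).card : ℕ) : ℝ) := by
    rw [hBuch]; push_cast; rfl
  -- the four estimates
  have hxz : Real.log x / Real.log z = k := by rw [hz_log]; field_simp
  have hR1 := hPsame x z hz2 hzx (le_of_eq (by rw [hz_log]; field_simp))
  rw [hxz, hMdef] at hR1
  have hR2 := abs_sum_cell_sub_sum_main_le (F := F) (i := i) hC' hC₀ hE hea hab hlb hy1 hx0.le
    hPprev hpy hpx hxp
  have hR3 := abs_sum_weight_sub_main_le (σ := fun s => F i s / s) hk hC₀ hE hea hay hya hab hbz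
    hzb hyz hz_log hyu hxa hlb hx1 hB hB' hσc hσ hσ'c hσb hσ'b
  have hR4 := Literature.NumberTheory.LFunctions.sum_primes_Ioc_div_log_le hea hab hC₀ hE
  -- the secondary terms `[i = 0] p/log p`
  set V := ∑ p ∈ S, (p : ℝ) / Real.log p with hV
  set W := ∑ p ∈ S, (if i = 0 then (p : ℝ) / Real.log p else 0) with hW
  have hV0 : 0 ≤ V := Finset.sum_nonneg fun p hp => by
    have h2 := (Finset.mem_filter.mp hp).2.two_le
    have : (2 : ℝ) ≤ p := by exact_mod_cast h2
    have : 0 < Real.log p := Real.log_pos (by linarith)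
    positivity
  have hW0 : 0 ≤ W := by
    rw [hW]
    split_ifs
    · exact hV0
    · simp
  have hWV : W ≤ V := by
    rw [hW]
    split_ifs
    · exact le_rfl
    · simp [hV0]
  -- rewriting the main terms of the pieces through the weight `σ(s) = F_i(s)/s`
  have hsplit : ∑ p ∈ S, (x / p * F i (Real.log x / Real.log p - 1) / (Real.log x - Real.log p) -
      if i = 0 then (p : ℝ) / Real.log p else 0) =
      ∑ p ∈ S, x * (F i (Real.log x / Real.log p - 1) / (Real.log x / Real.log p - 1)) /
        (p * Real.log p) - W := by
    rw [hW, ← Finset.sum_sub_distrib]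
    refine Finset.sum_congr rfl fun p hp => ?_
    have hp2 := (Finset.mem_filter.mp hp).2.two_le
    have hp2' : (2 : ℝ) ≤ p := by exact_mod_cast hp2
    have hp0 : (0 : ℝ) < p := by linarith
    have hlp : 0 < Real.log p := Real.log_pos (by linarith)
    have hxlp : Real.log p < Real.log x := by
      have h1 := hxp p hp
      have hpb : (p : ℝ) ≤ b := by
        have := (Finset.mem_filter.mp hp).1
        rw [Finset.mem_Ioc] at this
        have h3 : (p : ℝ) ≤ ⌊b⌋₊ := by exact_mod_cast this.2
        exact h3.trans (Nat.floor_le hb0.le)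
      have hlpz : Real.log p < Real.log z := Real.log_lt_log hp0 (hpb.trans_lt hbz)
      have hk' : (k : ℝ) * Real.log p < Real.log x := by
        calc (k : ℝ) * Real.log p < k * Real.log z := by gcongr
          _ = Real.log x := by rw [hz_log]; field_simp
      have h2 : 2 * Real.log p ≤ (k : ℝ) * Real.log p := mul_le_mul_of_nonneg_right hk2 hlp.le
      linarith
    have hne : Real.log x - Real.log p ≠ 0 := by linarith
    set A := F i (Real.log x / Real.log p - 1) with hA_def
    have hs : Real.log x / Real.log p - 1 = (Real.log x - Real.log p) / Real.log p := by
      rw [sub_div, div_self hlp.ne']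
    rw [hs, sub_left_inj]
    field_simp
  -- the algebraic identity behind the main terms
  set u := Real.log x / Real.log y with hu_def
  have hmain_eq : ((((roughIcc N X).filter
        (fun b => ArithmeticFunction.cardFactors b = i + 1 + 1)).card : ℕ) : ℝ) -
      x * F (i + 1) u / Real.log x =
      (((((roughIcc M X).filter
        (fun b => ArithmeticFunction.cardFactors b = i + 1 + 1)).card : ℕ) : ℝ) -
          x * F (i + 1) k / Real.log x) +
      (∑ p ∈ S, ((((roughIcc p (X / p)).filter
          (fun b => ArithmeticFunction.cardFactors b = i + 1)).card : ℕ) : ℝ) -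
        ∑ p ∈ S, (x / p * F i (Real.log x / Real.log p - 1) / (Real.log x - Real.log p) -
          if i = 0 then (p : ℝ) / Real.log p else 0)) +
      (∑ p ∈ S, x * (F i (Real.log x / Real.log p - 1) / (Real.log x / Real.log p - 1)) /
          (p * Real.log p) -
        x / Real.log x * ∫ s in ((k : ℝ) - 1)..(u - 1), F i s / s) - W := by
    rw [hΦ, hsplit, hrec]
    field_simp
    ring
  -- conversion of all bounds to multiples of `U = x/log² y`
  set U := x / Real.log y ^ 2 with hU
  have hU0 : 0 ≤ U := by positivity
  have hlz0 : 0 < Real.log z := by linarith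
  have hratio : 1 / Real.log a ^ 2 ≤ 4 / Real.log y ^ 2 := by
    rw [div_le_div_iff₀ (by positivity) (by positivity)]
    have h := mul_le_mul hlya hlya hly.le (by linarith)
    linarith
  have hxa4 : x / Real.log a ^ 2 ≤ 4 * U := by
    calc x / Real.log a ^ 2 = x * (1 / Real.log a ^ 2) := by ring
      _ ≤ x * (4 / Real.log y ^ 2) := by gcongr
      _ = 4 * U := by rw [hU]; ring
  have hb1 : C * x / Real.log z ^ 2 ≤ C * U := by
    rw [hU, ← mul_div_assoc]
    gcongr
  have hb2 : C' * (3 + 8 * C₀) * x / Real.log y ^ 2 = C' * (3 + 8 * C₀) * U := by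
    rw [hU]; ring
  set c₃ := (2 + 3 * (2 * (k + 1) * B' + 3 * B)) * C₀ * (B + 1) + 2 * B with hc₃
  have hc₃0 : 0 ≤ c₃ := by positivity
  have hb3 : c₃ * x / Real.log a ^ 2 ≤ 4 * c₃ * U := by
    calc c₃ * x / Real.log a ^ 2 = c₃ * (x / Real.log a ^ 2) := by ring
      _ ≤ c₃ * (4 * U) := by gcongr
      _ = _ := by ring
  have hb4 : (1 + 5 * C₀) * b ^ 2 / Real.log a ^ 2 ≤ 4 * (1 + 5 * C₀) * U := by
    have hbz' : b ^ 2 ≤ z * z := by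
      rw [sq]; exact mul_le_mul hbz.le hbz.le hb0.le hz0.le
    have hb2x : b ^ 2 ≤ x := hbz'.trans hzz
    calc (1 + 5 * C₀) * b ^ 2 / Real.log a ^ 2 = (1 + 5 * C₀) * (b ^ 2 * (1 / Real.log a ^ 2)) := by
          ring
      _ ≤ (1 + 5 * C₀) * (x * (4 / Real.log y ^ 2)) := by gcongr
      _ = 4 * (1 + 5 * C₀) * U := by rw [hU]; ring
  -- assembly
  rw [hNdef, hmain_eq]
  set A := ((((roughIcc M X).filter
        (fun b => ArithmeticFunction.cardFactors b = i + 1 + 1)).card : ℕ) : ℝ) -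
          x * F (i + 1) k / Real.log x with hA
  set Bs := ∑ p ∈ S, ((((roughIcc p (X / p)).filter
          (fun b => ArithmeticFunction.cardFactors b = i + 1)).card : ℕ) : ℝ) -
        ∑ p ∈ S, (x / p * F i (Real.log x / Real.log p - 1) / (Real.log x - Real.log p) -
          if i = 0 then (p : ℝ) / Real.log p else 0) with hBs
  set D := ∑ p ∈ S, x * (F i (Real.log x / Real.log p - 1) / (Real.log x / Real.log p - 1)) /
          (p * Real.log p) -
        x / Real.log x * ∫ s in ((k : ℝ) - 1)..(u - 1), F i s / s with hD
  have htri : |A + Bs + D - W| ≤ |A| + |Bs| + |D| + W := by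
    have h2 := abs_sub (A + Bs + D) W
    have h3 := abs_add_le (A + Bs) D
    have h4 := abs_add_le A Bs
    rw [abs_of_nonneg hW0] at h2
    linarith
  have eA : |A| ≤ C * U := hR1.trans hb1
  have eB : |Bs| ≤ C' * (3 + 8 * C₀) * U := hb2 ▸ hR2
  have eD : |D| ≤ 4 * c₃ * U := hR3.trans hb3
  have eW : W ≤ 4 * (1 + 5 * C₀) * U := hWV.trans (hR4.trans hb4)
  calc |A + Bs + D - W| ≤ |A| + |Bs| + |D| + W := htri
    _ ≤ C * U + C' * (3 + 8 * C₀) * U + 4 * c₃ * U + 4 * (1 + 5 * C₀) * U := by linarith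
    _ = (C + C' * (3 + 8 * C₀) + 4 * c₃ + 4 * (1 + 5 * C₀)) * U := by ring
    _ = _ := by rw [hU, hc₃]; ring

end Literature.NumberTheory.Sieve

end
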